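import Summits.AtomisticToContinuum.Crystallization.Theorems.OnePercentCertificate.Negative.ValueLowerBound
import Summits.AtomisticToContinuum.Crystallization.Theorems.ThreeConeCertificateTrialStateUpper
import Summits.AtomisticToContinuum.Crystallization.Theorems.ThreeConeCertificateEnergeticHalf
import Summits.AtomisticToContinuum.Crystallization.Theorems.LayeredLawsSelectHcp.Negative.Threshold

/-!
# `OnePercentCertificate` (stmt-AtomisticToContinuum-11958) — periodic tightness of three-cone certificates

Supports file of the line `Sketch` (continuation lead c1).  The VALUE `c + f 0 / 2` of ANY admissible
three-cone split `V_LJ = g + U + f` (decomposition on `(0,∞)`, `U ≥ 0`, `f` of positive type on `ℝ³`,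
`g` `c`-stable; the range `5/2` is not used) is bounded below by the negative of the Lennard-Jones energy
per particle of EVERY periodic configuration of `ℝ³`:

* `value_ge_neg_energyPerParticle : -(Q.energyPerParticle V_LJ) ≤ c + f 0 / 2` — the certificate gives
  `E(N) ≥ -(c + f 0/2)·N` (tree `onePercentCertificate_value_lower_bound` + `le_groundStateEnergy_div_of_forall_le`),
  and the PROVED trial-state upper bound `trialStateUpper_proof` (`E(N)/N ≤ e(Q) + ε` eventually) squeezes.
* `not_threeConeCertificate_of_lt_neg_energyPerParticle` — hence no certificate of value `b < -e(Q)` exists,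
  for any periodic `Q` (the crux's ladder `CertificateWithValue b` is refuted below `-inf_Q e(Q) ≈ 0.7176`).
* `not_threeConeCertificate_of_lt_half` — the certified rung: with the tree's `energyPerParticle_fccPC_one_le`
  (`e(fcc, a = 1) ≤ -1/2`) every `b < 1/2` is refuted (previous certified rung: `3677/13000 ≈ 0.2829` from the
  icosahedral `13`-cluster, `not_threeConeCertificate_ico`).  Sharper rungs follow from any sharper certified
  periodic energy bound through the second theorem (informal threshold `0.71760`, the crux asks `29/40 = 0.725`).

All `[folklore]` (Blanc–Lewin 2015 §1.3 (8), §2.1 for the trial-state bound; Ruelle 1969 §3.2 for the mechanism).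
-/

noncomputable section

namespace Summit.AtomisticToContinuum.Crystallization.Theorems.OnePercentTightness

open scoped BigOperators
open Filter
open Literature.MathematicalPhysics.StatisticalMechanics
open Summit.AtomisticToContinuum.Crystallization.Theorems
open Summit.AtomisticToContinuum.Crystallization.Theorems.LayeredLawsSelectHcp.Negative.FccEnergy (fccPC)
open Summit.AtomisticToContinuum.Crystallization.Theorems.LayeredLawsSelectHcp.Negative.Threshold
  (energyPerParticle_fccPC_one_le)

variable {c : ℝ} {g U f : ℝ → ℝ}

/-- **Periodic tightness of three-cone certificates.** For every admissible split `V_LJ = g + U + f` on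
`(0,∞)` (`U ≥ 0`, `f` of positive type, `g` `c`-stable) and every periodic configuration `Q` of `ℝ³`,
`-e(Q) ≤ c + f(0)/2`: the certificate bounds `E(N)/N` below by `-(c + f 0/2)` for `N ≥ 1`, the trial-state
upper bound (`trialStateUpper_proof`) bounds it above by `e(Q) + ε` eventually. [folklore] -/
theorem value_ge_neg_energyPerParticle
    (hdec : ∀ r : ℝ, 0 < r → lennardJones r = g r + U r + f r)
    (hU : ∀ r : ℝ, 0 < r → 0 ≤ U r)
    (hpos : ∀ (n : ℕ) (y : Fin n → EuclideanSpace ℝ (Fin 3)) (w : Fin n → ℝ),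
      0 ≤ ∑ i, ∑ j, w i * w j * f (dist (y i) (y j)))
    (hstab : ∀ (N : ℕ) (x : Fin N → EuclideanSpace ℝ (Fin 3)), Function.Injective x →
      -(c * (N : ℝ)) ≤ interactionEnergy g x)
    (Q : PeriodicConfiguration 3) :
    -(Q.energyPerParticle lennardJones) ≤ c + f 0 / 2 := by
  -- lower bound `-(c + f 0/2) ≤ E(N)/N` for `N ≥ 1`
  have hlow : ∀ N : ℕ, 1 ≤ N → -(c + f 0 / 2) ≤ groundStateEnergy lennardJones 3 N / N := by
    intro N hN
    refine le_groundStateEnergy_div_of_forall_le hN fun x hx => ?_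
    have h := onePercentCertificate_value_lower_bound hdec hU hpos hstab hx
    linarith
  -- trial-state upper bound, proved in the tree
  have hT := trialStateUpper_proof
  unfold Summit.AtomisticToContinuum.Crystallization.Theses.ThreeConeCertificate.TrialStateUpper at hT
  have hle : -(c + f 0 / 2) ≤ Q.energyPerParticle lennardJones := by
    refine le_of_forall_pos_le_add fun ε hε => ?_
    obtain ⟨N, hN₁, hN₂⟩ := ((hT Q ε hε).and (eventually_ge_atTop 1)).exists
    exact (hlow N hN₂).trans hN₁
  linarith

/-- **No three-cone certificate below a periodic energy.** If `b < -e(Q)` for some periodic configuration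
`Q` of `ℝ³`, then there is no admissible split of value `≤ b` (of any range; the range clause is kept in the
statement so that it is literally the crux's shape with `29/40` replaced by `b`). [folklore] -/
theorem not_threeConeCertificate_of_lt_neg_energyPerParticle {b ρ : ℝ} (Q : PeriodicConfiguration 3)
    (hb : b < -(Q.energyPerParticle lennardJones)) :
    ¬ ∃ (c : ℝ) (g U f : ℝ → ℝ), (∀ r : ℝ, 0 < r → lennardJones r = g r + U r + f r) ∧
      (∀ r : ℝ, 0 < r → 0 ≤ U r) ∧ (∀ r : ℝ, ρ ≤ r → g r = 0) ∧
      (∀ (n : ℕ) (y : Fin n → EuclideanSpace ℝ (Fin 3)) (w : Fin n → ℝ),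
        0 ≤ ∑ i, ∑ j, w i * w j * f (dist (y i) (y j))) ∧
      (∀ (N : ℕ) (x : Fin N → EuclideanSpace ℝ (Fin 3)), Function.Injective x →
        -(c * (N : ℝ)) ≤ interactionEnergy g x) ∧
      c + f 0 / 2 ≤ b :=
  fun ⟨_, _, _, _, hdec, hU, _, hpos, hstab, hval⟩ =>
    (lt_of_le_of_lt hval hb).not_ge (value_ge_neg_energyPerParticle hdec hU hpos hstab Q)

/-- **Certified rung `1/2`.** No three-cone certificate (of any range `ρ`) has value `b < 1/2`: test the fcc
lattice at nearest-neighbour distance `1`, whose energy per particle is `≤ -1/2` (tree: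
`energyPerParticle_fccPC_one_le`). In particular the crux's constant `29/40` cannot be lowered below `1/2`
(informally not below `0.7176`). [folklore] -/
theorem not_threeConeCertificate_of_lt_half {b ρ : ℝ} (hb : b < 1 / 2) :
    ¬ ∃ (c : ℝ) (g U f : ℝ → ℝ), (∀ r : ℝ, 0 < r → lennardJones r = g r + U r + f r) ∧
      (∀ r : ℝ, 0 < r → 0 ≤ U r) ∧ (∀ r : ℝ, ρ ≤ r → g r = 0) ∧
      (∀ (n : ℕ) (y : Fin n → EuclideanSpace ℝ (Fin 3)) (w : Fin n → ℝ),
        0 ≤ ∑ i, ∑ j, w i * w j * f (dist (y i) (y j))) ∧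
      (∀ (N : ℕ) (x : Fin N → EuclideanSpace ℝ (Fin 3)), Function.Injective x →
        -(c * (N : ℝ)) ≤ interactionEnergy g x) ∧
      c + f 0 / 2 ≤ b :=
  not_threeConeCertificate_of_lt_neg_energyPerParticle (fccPC one_ne_zero) (by
    have h := energyPerParticle_fccPC_one_le
    linarith)

/-- **The crux's own value is within `[1/2, 29/40]` of the certified window**: `OnePercentCertificate`
asserts a certificate of value `≤ 29/40` at range `5/2`; by the rung above none exists of value `< 1/2`.
Stated as: every admissible split at range `5/2` has value `≥ 1/2`. [folklore] -/
theorem onePercentCertificate_value_ge_half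
    (hdec : ∀ r : ℝ, 0 < r → lennardJones r = g r + U r + f r)
    (hU : ∀ r : ℝ, 0 < r → 0 ≤ U r)
    (hpos : ∀ (n : ℕ) (y : Fin n → EuclideanSpace ℝ (Fin 3)) (w : Fin n → ℝ),
      0 ≤ ∑ i, ∑ j, w i * w j * f (dist (y i) (y j)))
    (hstab : ∀ (N : ℕ) (x : Fin N → EuclideanSpace ℝ (Fin 3)), Function.Injective x →
      -(c * (N : ℝ)) ≤ interactionEnergy g x) :
    (1 / 2 : ℝ) ≤ c + f 0 / 2 := by
  have h := value_ge_neg_energyPerParticle hdec hU hpos hstab (fccPC one_ne_zero)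
  have h2 := energyPerParticle_fccPC_one_le
  linarith


/-- **Registered rung** (sub-goal `threeCone_noCertificate_below_half` of the crux item): for every bound
`b < 1/2` and every range `ρ`, there is no three-cone certificate of value `≤ b`. [folklore] -/
theorem threeCone_noCertificate_below_half : ∀ (b ρ : ℝ), b < 1 / 2 → ¬ ∃ (c : ℝ) (g U f : ℝ → ℝ), (∀ r : ℝ, 0 < r → lennardJones r = g r + U r + f r) ∧ (∀ r : ℝ, 0 < r → 0 ≤ U r) ∧ (∀ r : ℝ, ρ ≤ r → g r = 0) ∧ (∀ (n : ℕ) (y : Fin n → EuclideanSpace ℝ (Fin 3)) (w : Fin n → ℝ), 0 ≤ ∑ i, ∑ j, w i * w j * f (dist (y i) (y j))) ∧ (∀ (N : ℕ) (x : Fin N → EuclideanSpace ℝ (Fin 3)), Function.Injective x → -(c * (N : ℝ)) ≤ interactionEnergy g x) ∧ c + f 0 / 2 ≤ b :=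
  fun _ _ hb => not_threeConeCertificate_of_lt_half hb

end Summit.AtomisticToContinuum.Crystallization.Theorems.OnePercentTightness
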